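import Summits.BirchSwinnertonDyer.Uniform.U2.TwoTorsionDihedral
import HarnessLib

/-!
# Cell «bsd-uniform», track U2, route C — L1 combinatorial half, part 2: the structure theorem

HONEST FRAMING (cell «bsd-uniform», run/shared/lean/pub/bsd-uniform/, seat u2-p1): PURE ALGEBRA,
continuation of `TwoTorsionDihedral.lean` (same setting: `ρ : Γ →* AddMonoid.End M`, `A ≤ Γ` with
commuting elements, `τ ∉ A` inverting `A`, `Γ = A ∪ τA`, at most three non-zero `2`-torsion elements
`T = {P₁, P₂, P₁ + P₂}`, none `Γ`-fixed). No field, no curve, no claim about BSD.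

* `cases_of_mem`: every `b ∈ A` induces the identity or a `3`-cycle on `T` (a transposition's fixed
  point would be `A`-fixed — `A` abelian — contradicting `exists_apply_ne`); `apply_apply_apply_eq`:
  `b³` fixes `T` pointwise.
* `cases_tau`: `τ` induces a transposition (`τ̄ = id` forces `b̄ = b̄⁻¹` for a `3`-cycle `b̄`; a
  `3`-cycle `τ̄` contradicts `τ⁴ = 1`).
* `exists_triple`: the STRUCTURE THEOREM consumed by the field half (`RingClassNoTwoTorsion.lean`):
  from one `Q ∈ T`, three elements `P₁, P₂, P₃` exhausting `T`, cubes of `A` trivial on `T`, and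
  `τ` swapping `P₁, P₂`, fixing `P₃`.

References: T4-PROOF.md v1.9b §3 L1 (HOME); Cox, *Primes of the form x² + ny²*, 2nd ed., Lemma 9.3
[Cox2013]; Silverman AEC III.§1 [SilvermanAEC2009].
-/

set_option autoImplicit false

namespace Summit.BirchSwinnertonDyer.Uniform.U2.TwoTorsionDihedral

variable {M : Type*} [AddCommGroup M] {Γ : Type*} [Group Γ] {ρ : Γ →* AddMonoid.End M}

/-! ## §5 Which permutations `A` and `τ` induce on the triple -/

section Main

variable {A : Subgroup Γ} {τ : Γ}
  (hcomm : ∀ a ∈ A, ∀ b ∈ A, a * b = b * a)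
  (hconj : ∀ a ∈ A, τ * a * τ⁻¹ = a⁻¹) (hτ : τ ∉ A) (hcover : ∀ g : Γ, g ∈ A ∨ τ⁻¹ * g ∈ A)
  (hfix : ∀ P : M, P ≠ 0 ∧ (2 : ℕ) • P = 0 → ∃ g : Γ, ρ g P ≠ P)
  {P₁ P₂ : M} (h₁ : P₁ ≠ 0 ∧ (2 : ℕ) • P₁ = 0) (h₂ : P₂ ≠ 0 ∧ (2 : ℕ) • P₂ = 0) (h12 : P₁ ≠ P₂)
  (hall : ∀ P : M, P ≠ 0 ∧ (2 : ℕ) • P = 0 → P = P₁ ∨ P = P₂ ∨ P = P₁ + P₂)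

include h₂ in
/-- `P₁ ≠ P₁ + P₂` (as `P₂ ≠ 0`). [folklore] -/
theorem ne_add_left' : P₁ ≠ P₁ + P₂ := fun h => h₂.1 (left_eq_add.mp h)

include h₁ in
/-- `P₂ ≠ P₁ + P₂` (as `P₁ ≠ 0`). [folklore] -/
theorem ne_add_right' : P₂ ≠ P₁ + P₂ := fun h => h₁.1 (left_eq_add.mp (h.trans (add_comm P₁ P₂)))

include hcomm hconj hτ hcover hfix h₁ h₂ h12 hall in
/-- **`A` acts by the identity or a `3`-cycle.** For `b ∈ A` the transpositions are excluded: the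
fixed point of a transposition would be `A`-fixed (the `A`-orbit of a `b̄`-fixed point consists of
`b̄`-fixed points, `A` being abelian), contradicting (H3). [folklore] -/
theorem cases_of_mem {b : Γ} (hb : b ∈ A) :
    (ρ b P₁ = P₁ ∧ ρ b P₂ = P₂) ∨ (ρ b P₁ = P₂ ∧ ρ b P₂ = P₁ + P₂) ∨
    (ρ b P₁ = P₁ + P₂ ∧ ρ b P₂ = P₁) := by
  have h₃ : (P₁ + P₂) ≠ 0 ∧ (2 : ℕ) • (P₁ + P₂) = 0 := add_mem h₁ h₂ h12
  have h13 := ne_add_left' (P₁ := P₁) h₂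
  have h23 := ne_add_right' (P₂ := P₂) h₁
  -- commuting elements preserve fixed points
  have hcom : ∀ c ∈ A, ∀ F : M, ρ b F = F → ρ b (ρ c F) = ρ c F := by
    intro c hc F hF
    rw [← mul_apply, hcomm b hb c hc, mul_apply, hF]
  rcases perm_cases h₁ h₂ h12 hall b with hc | hc | hc | hc | hc | hc
  · exact Or.inl hc
  · -- transposition fixing `P₁`
    exfalso
    have hb3 : ρ b (P₁ + P₂) = P₂ := by rw [map_add, hc.1, hc.2, add_add_eq_right h₁]
    obtain ⟨c, hcA, hcne⟩ := exists_apply_ne hconj hτ hcover hfix h₁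
    rcases hall _ (apply_mem ρ c h₁) with h | h | h
    · exact hcne h
    · have := hcom c hcA P₁ hc.1; rw [h, hc.2] at this; exact h23 this.symm
    · have := hcom c hcA P₁ hc.1; rw [h, hb3] at this; exact h23 this
  · -- transposition fixing `P₃`
    exfalso
    have hb3 : ρ b (P₁ + P₂) = P₁ + P₂ := by rw [map_add, hc.1, hc.2, add_comm]
    obtain ⟨c, hcA, hcne⟩ := exists_apply_ne hconj hτ hcover hfix h₃
    rcases hall _ (apply_mem ρ c h₃) with h | h | h
    · have := hcom c hcA _ hb3; rw [h, hc.1] at this; exact h12 this.symm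
    · have := hcom c hcA _ hb3; rw [h, hc.2] at this; exact h12 this
    · exact hcne h
  · exact Or.inr (Or.inl hc)
  · exact Or.inr (Or.inr hc)
  · -- transposition fixing `P₂`
    exfalso
    have hb3 : ρ b (P₁ + P₂) = P₁ := by rw [map_add, hc.1, hc.2, add_comm, add_add_eq_left h₂]
    obtain ⟨c, hcA, hcne⟩ := exists_apply_ne hconj hτ hcover hfix h₂
    rcases hall _ (apply_mem ρ c h₂) with h | h | h
    · have := hcom c hcA P₂ hc.2; rw [h, hc.1] at this; exact h13 this.symm
    · exact hcne h
    · have := hcom c hcA P₂ hc.2; rw [h, hb3] at this; exact h13 this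

include hcomm hconj hτ hcover hfix h₁ h₂ h12 hall in
/-- The cube of every `b ∈ A` fixes `M[2] ∖ 0` pointwise. [folklore] -/
theorem apply_apply_apply_eq {b : Γ} (hb : b ∈ A) (P : M) (hP : P ≠ 0 ∧ (2 : ℕ) • P = 0) :
    ρ b (ρ b (ρ b P)) = P := by
  have key : ρ b (ρ b (ρ b P₁)) = P₁ ∧ ρ b (ρ b (ρ b P₂)) = P₂ := by
    rcases cases_of_mem hcomm hconj hτ hcover hfix h₁ h₂ h12 hall hb with hc | hc | hc
    · simp only [hc.1, hc.2, and_self]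
    · have hb3 : ρ b (P₁ + P₂) = P₁ := by rw [map_add, hc.1, hc.2, add_add_eq_left h₂]
      refine ⟨?_, ?_⟩
      · rw [hc.1, hc.2, hb3]
      · rw [hc.2, hb3, hc.1]
    · have hb3 : ρ b (P₁ + P₂) = P₂ := by rw [map_add, hc.1, hc.2, add_comm, add_add_eq_right h₁]
      refine ⟨?_, ?_⟩
      · rw [hc.1, hb3, hc.2]
      · rw [hc.2, hc.1, hb3]
  rcases hall P hP with rfl | rfl | rfl
  · exact key.1
  · exact key.2
  · simp only [map_add, key.1, key.2]

include hcomm hconj hτ hcover hfix h₁ h₂ h12 hall in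
/-- **`τ` acts by a transposition.** `τ̄ = id` would force `b̄ = b̄⁻¹` for a `3`-cycle `b ∈ A`
moving `P₁` (H3); a `3`-cycle `τ̄` contradicts `τ⁴ = 1`. [folklore] -/
theorem cases_tau :
    (ρ τ P₁ = P₁ ∧ ρ τ P₂ = P₁ + P₂) ∨ (ρ τ P₁ = P₂ ∧ ρ τ P₂ = P₁) ∨
    (ρ τ P₁ = P₁ + P₂ ∧ ρ τ P₂ = P₂) := by
  have h13 := ne_add_left' (P₁ := P₁) h₂
  have h23 := ne_add_right' (P₂ := P₂) h₁
  rcases perm_cases h₁ h₂ h12 hall τ with hc | hc | hc | hc | hc | hc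
  · -- `τ̄ = id`
    exfalso
    obtain ⟨b, hbA, hbne⟩ := exists_apply_ne hconj hτ hcover hfix h₁
    have hτ3 : ρ τ (P₁ + P₂) = P₁ + P₂ := by rw [map_add, hc.1, hc.2]
    have hτinv : ρ τ⁻¹ P₁ = P₁ := by
      conv_lhs => rw [← hc.1]
      exact inv_apply_apply ρ τ P₁
    have hrel : ρ τ (ρ b (ρ τ⁻¹ P₁)) = ρ b⁻¹ P₁ := by
      rw [← mul_apply, ← mul_apply, hconj b hbA]
    rw [hτinv] at hrel
    rcases cases_of_mem hcomm hconj hτ hcover hfix h₁ h₂ h12 hall hbA with hb | hb | hb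
    · exact hbne hb.1
    · have hb3 : ρ b (P₁ + P₂) = P₁ := by rw [map_add, hb.1, hb.2, add_add_eq_left h₂]
      have hbinv : ρ b⁻¹ P₁ = P₁ + P₂ := by
        conv_lhs => rw [← hb3]
        exact inv_apply_apply ρ b _
      rw [hb.1, hc.2, hbinv] at hrel
      exact h23 hrel
    · have hbinv : ρ b⁻¹ P₁ = P₂ := by
        conv_lhs => rw [← hb.2]
        exact inv_apply_apply ρ b _
      rw [hb.1, hτ3, hbinv] at hrel
      exact h23 hrel.symm
  · exact Or.inl hc
  · exact Or.inr (Or.inl hc)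
  · -- `3`-cycle
    exfalso
    have h4 := tau_pow_four hconj (tau_sq_mem hτ hcover)
    have hτ3 : ρ τ (P₁ + P₂) = P₁ := by rw [map_add, hc.1, hc.2, add_add_eq_left h₂]
    have : ρ (τ * τ * (τ * τ)) P₁ = P₁ := by rw [h4, map_one]; rfl
    rw [mul_apply, mul_apply, mul_apply, hc.1, hc.2, hτ3, hc.1] at this
    exact h12 this.symm
  · -- the other `3`-cycle
    exfalso
    have h4 := tau_pow_four hconj (tau_sq_mem hτ hcover)
    have hτ3 : ρ τ (P₁ + P₂) = P₂ := by rw [map_add, hc.1, hc.2, add_comm, add_add_eq_right h₁]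
    have : ρ (τ * τ * (τ * τ)) P₁ = P₁ := by rw [h4, map_one]; rfl
    rw [mul_apply, mul_apply, mul_apply, hc.1, hτ3, hc.2, hc.1] at this
    exact h13 this.symm
  · exact Or.inr (Or.inr hc)

end Main

/-! ## §6 The structure theorem -/

section Structure

variable {A : Subgroup Γ} {τ : Γ}

/-- **STRUCTURE THEOREM (combinatorial half of L1).** Let `Γ` act additively on `M`, `A ≤ Γ`
abelian, `τ ∉ A` with `τ a τ⁻¹ = a⁻¹` on `A` and `Γ = A ∪ τA` (a generalized dihedral group, e.g.
`Gal(K[n]/ℚ) ⊇ Gal(K[n]/K)` with complex conjugation). Suppose the non-zero `2`-torsion elements of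
`M` number at most three (an injection `φ` into a set `R` with `#R ≤ 3` — for `M = E(K[n])`: the
`x`-coordinate into the roots of the `2`-division cubic), none of them is `Γ`-fixed (no rational
`2`-torsion), and one exists (`Q`). Then there are exactly three, `P₁, P₂, P₃`, the cube of every
element of `A` fixes them, and `τ` swaps `P₁, P₂` and fixes `P₃`. [folklore] -/
theorem exists_triple (hcomm : ∀ a ∈ A, ∀ b ∈ A, a * b = b * a)
    (hconj : ∀ a ∈ A, τ * a * τ⁻¹ = a⁻¹) (hτ : τ ∉ A) (hcover : ∀ g : Γ, g ∈ A ∨ τ⁻¹ * g ∈ A)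
    (hfix : ∀ P : M, P ≠ 0 ∧ (2 : ℕ) • P = 0 → ∃ g : Γ, ρ g P ≠ P)
    {X : Type*} (φ : M → X) (R : Finset X) (hR : R.card ≤ 3)
    (hφR : ∀ P : M, P ≠ 0 ∧ (2 : ℕ) • P = 0 → φ P ∈ R)
    (hφinj : ∀ P Q : M, P ≠ 0 ∧ (2 : ℕ) • P = 0 → Q ≠ 0 ∧ (2 : ℕ) • Q = 0 → φ P = φ Q → P = Q)
    {Q : M} (hQ : Q ≠ 0 ∧ (2 : ℕ) • Q = 0) :
    ∃ P₁ P₂ P₃ : M, (P₁ ≠ 0 ∧ (2 : ℕ) • P₁ = 0) ∧ (P₂ ≠ 0 ∧ (2 : ℕ) • P₂ = 0) ∧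
      (P₃ ≠ 0 ∧ (2 : ℕ) • P₃ = 0) ∧ P₁ ≠ P₂ ∧ P₁ ≠ P₃ ∧ P₂ ≠ P₃ ∧
      (∀ P : M, P ≠ 0 ∧ (2 : ℕ) • P = 0 → P = P₁ ∨ P = P₂ ∨ P = P₃) ∧
      (∀ a ∈ A, ∀ P : M, P ≠ 0 ∧ (2 : ℕ) • P = 0 → ρ a (ρ a (ρ a P)) = P) ∧
      ρ τ P₁ = P₂ ∧ ρ τ P₂ = P₁ ∧ ρ τ P₃ = P₃ := by
  -- a second element: `A` moves `Q`
  obtain ⟨a, haA, hane⟩ := exists_apply_ne hconj hτ hcover hfix hQ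
  have hQ' : ρ a Q ≠ 0 ∧ (2 : ℕ) • ρ a Q = 0 := apply_mem ρ a hQ
  have h12 : Q ≠ ρ a Q := Ne.symm hane
  have hall := eq_or_eq_or_eq_add φ R hR hφR hφinj hQ hQ' h12
  have h3 : (Q + ρ a Q) ≠ 0 ∧ (2 : ℕ) • (Q + ρ a Q) = 0 := add_mem hQ hQ' h12
  have h13 : Q ≠ Q + ρ a Q := ne_add_left' hQ'
  have h23 : ρ a Q ≠ Q + ρ a Q := ne_add_right' hQ
  have hcube := fun b (hb : b ∈ A) =>
    apply_apply_apply_eq hcomm hconj hτ hcover hfix hQ hQ' h12 hall hb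
  rcases cases_tau hcomm hconj hτ hcover hfix hQ hQ' h12 hall with hc | hc | hc
  · -- `τ` fixes `P₁ = Q`, swaps `P₂`, `P₃`
    refine ⟨ρ a Q, Q + ρ a Q, Q, hQ', h3, hQ, h23, Ne.symm h12, Ne.symm h13, ?_, hcube, hc.2, ?_, hc.1⟩
    · intro P hP
      rcases hall P hP with h | h | h
      · exact Or.inr (Or.inr h)
      · exact Or.inl h
      · exact Or.inr (Or.inl h)
    · rw [map_add, hc.1, hc.2, add_add_eq_right hQ]
  · -- `τ` swaps `P₁`, `P₂`, fixes `P₃`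
    refine ⟨Q, ρ a Q, Q + ρ a Q, hQ, hQ', h3, h12, h13, h23, hall, hcube, hc.1, hc.2, ?_⟩
    rw [map_add, hc.1, hc.2, add_comm]
  · -- `τ` fixes `P₂`, swaps `P₁`, `P₃`
    refine ⟨Q, Q + ρ a Q, ρ a Q, hQ, h3, hQ', h13, h12, Ne.symm h23, ?_, hcube, hc.1, ?_, hc.2⟩
    · intro P hP
      rcases hall P hP with h | h | h
      · exact Or.inl h
      · exact Or.inr (Or.inr h)
      · exact Or.inr (Or.inl h)
    · rw [map_add, hc.1, hc.2, add_comm, add_add_eq_left hQ']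

end Structure

end Summit.BirchSwinnertonDyer.Uniform.U2.TwoTorsionDihedral
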